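import Summits.BirchSwinnertonDyer.BirchSwinnertonDyer.Theorems.RamifiedSevenEllipticUnitsPinnedCharacterRigiditySeven
import Literature.NumberTheory.EllipticCurves.DeShalit1987.KatzPAdicLFunctionFunctionalEquation
import Literature.NumberTheory.EllipticCurves.ComplexMultiplicationDeuringGrossencharacter
import Literature.NumberTheory.GaloisRepresentations.HeckeCharacterModulusExponentProofs
import HarnessLib

set_option linter.dupNamespace false
set_option autoImplicit false

/-!
# Crux `CycTangentCM.CycTangentBound` (stmt-BirchSwinnertonDyer-22628), stub `stub_selfDual`:
# SELF-DUALITY OF THE GRÖSSENCHARACTER — `ψ · (ψ ∘ c) = ‖·‖⁻¹`, hence `reflect ψ⁻¹ = ψ⁻¹` and `c • S = S`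

Seat `bsd-line-ctcm-p2` (line `tangent-cone-parity` of crux 22628, lead `bsd-line-ctcm-p1`). The
registered stub `stub_selfDual` (= the cite-only fact
`DeShalit1987.thmII64_selfDual_functionalEquation_cm`) bundles, beyond de Shalit II.6.4 as typed
(`DeShalit1987.thmII64_katzMeasure₂_functionalEquation`), the SELF-DUALITY of the branch `ψ_A⁻¹`:
`reflect ψ⁻¹ = ψ⁻¹` and `c • S = S` (docstring (a) of `KatzSelfDualFunctionalEquationCM.lean`: "the
conjugation-equivariance of `ψ_A`, which the crux's binders imply only through the uniqueness of the
Grössencharacter"). This file PROVES it for the crux's `ψ` (ANY Hecke character with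
`L(ψ,s) = L(A,s)`; its infinity type is not used), GRANTED ONLY the tree's cite-only Deuring fact
`Deuring_exists_heckeCharacter_of_maximalCM` (already an input of the route, item `KatzFrameInputs`):

* `mul_galConj_eq_normCharacter_inv_of_isHeckeConjEquivariant` — a conj-equivariant (`ψ(c•x) = conj ψ(x)`)
  Hecke character of type `(1,0)` of an imaginary quadratic field satisfies `ψ · (ψ ∘ c) = ‖·‖⁻¹`:
  `ψ(x)·conj ψ(x) = |ψ(x)|²`, and `|ψ| = ‖·‖^σ` (Weil) with `σ = −1/2`, read off at the principal
  infinite idele of `2` (`|ψ| = 1/2`, `‖·‖ = 4` there, by the infinity types of `ψ` and of `‖·‖`).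
* `mul_galConj_eq_normCharacter_inv` — the same for the crux's `ψ`: by the KERNEL rigidity theorem
  `RamifiedSevenEllipticUnits.Rigidity.eq_or_eq_galConj_of_heckeLFunction_eq` (equal `L`-functions ⟹
  `ψ = ψ_D ∨ ψ = ψ_D ∘ c`, `ψ_D` the Deuring character), and both alternatives have the same
  `ψ · (ψ ∘ c)`.
* `reflect_inv_eq_inv` — de Shalit's reflection fixes the branch: `reflect ψ⁻¹ = ψ⁻¹`.
* `isUnramifiedAt_smul_iff`, `image_smul_eq_self` — the exact ramification set `S` of `ψ` is
  conjugation-stable: `S.image (c • ·) = S`.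

THEOREMS ONLY (no `def`, no new fact, no `sorry`); conditional on the cite-only Deuring fact, displayed
as a hypothesis; supports, does not close, stmt-BirchSwinnertonDyer-22628. BSD is not proved by this.

References: [SilvermanATAEC1994] Ch. II Thm. 9.2, Thm. 10.5; [deShalit1987] II.1.4, II.6.1 (1), II.6.5;
[WeilBNT1967] Ch. VII §3 (quasi-characters = unitary × `‖·‖^σ`).
-/

noncomputable section

open scoped ComplexConjugate Classical
open NumberField IsDedekindDomain Field
open Literature.NumberTheory.GaloisRepresentations Literature.NumberTheory.EllipticCurves
open Summit.BirchSwinnertonDyer.BirchSwinnertonDyer.Theorems.RamifiedSevenEllipticUnits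
open Summit.BirchSwinnertonDyer.Rank1Residual.X11b

namespace Summit.BirchSwinnertonDyer.BirchSwinnertonDyer.Theorems.CycTangentCMCycTangentBoundSelfDualCharacter

variable {K : Type} [Field K] [NumberField K]

/-- In a quadratic field a non-trivial automorphism is an involution: `c * c = 1`.
[cite: NeukirchANT1999, Ch. I §9 (quadratic fields have Galois group of order 2)] -/
theorem mul_self_eq_one_of_ne_one (h2 : Module.finrank ℚ K = 2) {c : K ≃ₐ[ℚ] K} (hc : c ≠ 1) :
    c * c = 1 := by
  haveI : Algebra.IsQuadraticExtension ℚ K := ⟨h2⟩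
  by_contra h
  have hcc : c * c = c := Three.LambdaSupply.algEquiv_eq_of_ne_one_of_finrank_eq_two h2 h hc
  exact hc (mul_left_cancel (a := c) (by rw [hcc, mul_one]))

/-- **A conj-equivariant Hecke character of infinity type `(1, 0)` of an imaginary quadratic field is
self-dual: `ψ · (ψ ∘ c) = ‖·‖⁻¹`.** Pointwise `ψ(x)·ψ(c•x) = ψ(x)·conj ψ(x) = |ψ(x)|²`; Weil's
decomposition gives `|ψ| = ‖·‖^σ` for a real `σ`, and at the principal infinite idele `(2)_∞` the
infinity types give `|ψ((2)_∞)| = 1/2`, `‖(2)_∞‖ = 4`, so `σ = −1/2` and `|ψ|² = ‖·‖⁻¹`.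
[cite: WeilBNT1967, Ch. VII §3 Cor. 1–2 of Prop. 7] [cite: SilvermanATAEC1994, Ch. II Thm. 9.2] -/
theorem mul_galConj_eq_normCharacter_inv_of_isHeckeConjEquivariant (hK : IsImaginaryQuadratic K)
    {c : K ≃ₐ[ℚ] K} {ψ : HeckeCharacter K} (hψ : ψ.HasInfinityType (fun _ ↦ 1) (fun _ ↦ 0))
    (hconj : IsHeckeConjEquivariant c ψ) :
    ψ * HeckeCharacter.galConj c ψ = (HeckeCharacter.normCharacter K)⁻¹ := by
  classical
  haveI : IsTotallyComplex K := hK.2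
  haveI := subsingleton_infinitePlace_of_isImaginaryQuadratic hK
  obtain ⟨w₀⟩ : Nonempty (InfinitePlace K) := inferInstance
  -- Weil: `|ψ| = ‖·‖^σ`
  obtain ⟨σ, hσ⟩ := ψ.exists_norm_apply_eq_ideleNorm_rpow
  -- the principal infinite idele of `2`
  set k₀ : Kˣ := Units.mk0 (2 : K) two_ne_zero with hk₀
  set x₀ : ideleGroup K := infiniteIdeles K (globalToInfiniteUnits K k₀) with hx₀
  have hψx₀ : ‖((ψ x₀ : ℂˣ) : ℂ)‖ = 2⁻¹ := by
    rw [hx₀, Rigidity.coe_apply_infiniteIdeles_eq_of_hasInfinityType_one_zero hK w₀ hψ k₀, hk₀,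
      Units.val_mk0, map_ofNat, norm_inv, Complex.norm_ofNat]
  have hNx₀ : ideleNorm x₀ = 4 := by
    have hN := (HeckeCharacter.hasInfinityType_normCharacter' (K := K)).apply_globalToInfiniteUnits_eq_of_isTotallyComplex k₀
    rw [HeckeCharacter.normCharacter_apply, Fintype.prod_subsingleton _ w₀, hk₀, Units.val_mk0,
      map_ofNat, map_ofNat] at hN
    have hw₀ : ¬ w₀.IsReal := InfinitePlace.not_isReal_iff_isComplex.mpr (IsTotallyComplex.isComplex w₀)
    rw [if_neg hw₀] at hN
    norm_num at hN
    exact_mod_cast hN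
  -- `σ = -1/2`, in the form `2σ = -1`
  have h2σ : 2 * σ = -1 := by
    have h := hσ x₀
    rw [hψx₀, hNx₀] at h
    -- `2⁻¹ = 4 ^ σ`
    have hlog := congrArg Real.log h
    rw [Real.log_inv, Real.log_rpow (by norm_num : (0 : ℝ) < 4),
      show (4 : ℝ) = 2 ^ 2 by norm_num, Real.log_pow] at hlog
    have h2 : Real.log 2 ≠ 0 := (Real.log_pos one_lt_two).ne'
    push_cast at hlog
    have : Real.log 2 * (2 * σ + 1) = 0 := by linear_combination -hlog
    rcases mul_eq_zero.mp this with h0 | h0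
    · exact absurd h0 h2
    · linarith
  -- `|ψ(x)|² = ‖x‖⁻¹`
  have key : ∀ x : ideleGroup K, ‖((ψ x : ℂˣ) : ℂ)‖ ^ 2 = (ideleNorm x)⁻¹ := fun x ↦ by
    have hpos : 0 < ideleNorm x := by
      rw [← Literature.NumberTheory.Automorphic.coe_ideleNorm]
      exact NNReal.coe_pos.mpr (pos_iff_ne_zero.mpr (Literature.NumberTheory.Automorphic.ideleNorm_ne_zero x))
    rw [hσ x, ← Real.rpow_natCast, ← Real.rpow_mul hpos.le, Nat.cast_ofNat, mul_comm, h2σ,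
      Real.rpow_neg_one]
  refine HeckeCharacter.ext fun x ↦ Units.ext ?_
  rw [HeckeCharacter.mul_apply, Units.val_mul, hconj x, HeckeCharacter.inv_apply,
    Units.val_inv_eq_inv_val, HeckeCharacter.normCharacter_apply, Complex.mul_conj,
    Complex.normSq_eq_norm_sq, key x, Complex.ofReal_inv]

/-- **Self-duality of the crux's Grössencharacter.** Granted the cite-only Deuring fact, for a CM curve
`A/ℚ` with `A.j` a maximal-CM invariant, `K` its CM field, `c ≠ 1` the non-trivial automorphism of
`K`, and ANY Hecke character `ψ` of `K` with `L(ψ, s) = L(A, s)` on `re s > 3/2` (the binders of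
`CycTangentBound`; the infinity type `(1,0)` of the crux's `ψ` is not even needed): `ψ · (ψ ∘ c) = ‖·‖⁻¹`. By the kernel rigidity theorem
`Rigidity.eq_or_eq_galConj_of_heckeLFunction_eq`, `ψ` is the Deuring character `ψ_D` or `ψ_D ∘ c`;
either way `ψ·(ψ∘c) = ψ_D·(ψ_D∘c) = ‖·‖⁻¹`. [cite: SilvermanATAEC1994, Ch. II Thm. 9.2 and Thm. 10.5 (b)]
[cite: deShalit1987, II.1.4 (11)–(12) (store chunk 34–35)] -/
theorem mul_galConj_eq_normCharacter_inv (hD : Deuring_exists_heckeCharacter_of_maximalCM)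
    {A : WeierstrassCurve ℚ} [A.IsElliptic] [A.IsGloballyMinimal] (hj : A.j ∈ maximalCMJInvariants)
    (hK : IsCMFieldOfJ K A.j) (c : K ≃ₐ[ℚ] K) (hc : c ≠ 1) {ψ : HeckeCharacter K}
    (hL : ∀ s : ℂ, 3 / 2 < s.re → heckeLFunction ψ s = A.LSeries s) :
    ψ * HeckeCharacter.galConj c ψ = (HeckeCharacter.normCharacter K)⁻¹ := by
  have hKiq : IsImaginaryQuadratic K :=
    Deuring_exists_heckeCharacter_of_maximalCM.isImaginaryQuadratic hj hK
  obtain ⟨ψD, hDinf, hDconj, -, -, hDL⟩ := hD A hj K hK c hc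
  have hLL : ∀ s : ℂ, (3 / 2 : ℝ) < s.re → heckeLFunction ψ s = heckeLFunction ψD s :=
    fun s hs ↦ by rw [hL s hs, hDL s hs]
  have hDD := mul_galConj_eq_normCharacter_inv_of_isHeckeConjEquivariant hKiq hDinf hDconj
  rcases Rigidity.eq_or_eq_galConj_of_heckeLFunction_eq hKiq c hc hDinf (3 / 2) hLL with h | h
  · rw [h]
    exact hDD
  · rw [h, HeckeCharacter.galConj_galConj, mul_self_eq_one_of_ne_one hKiq.1 hc,
      HeckeCharacter.galConj_one, mul_comm]
    exact hDD

/-- **`(ψ ∘ c) = ψ⁻¹ · ‖·‖⁻¹`** — the conjugate of the crux's Grössencharacter (granted Deuring).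
[cite: SilvermanATAEC1994, Ch. II Thm. 10.5 (b)] -/
theorem galConj_eq_inv_mul_normCharacter_inv (hD : Deuring_exists_heckeCharacter_of_maximalCM)
    {A : WeierstrassCurve ℚ} [A.IsElliptic] [A.IsGloballyMinimal] (hj : A.j ∈ maximalCMJInvariants)
    (hK : IsCMFieldOfJ K A.j) (c : K ≃ₐ[ℚ] K) (hc : c ≠ 1)
    {ψ : HeckeCharacter K} (hL : ∀ s : ℂ, 3 / 2 < s.re → heckeLFunction ψ s = A.LSeries s) :
    HeckeCharacter.galConj c ψ = ψ⁻¹ * (HeckeCharacter.normCharacter K)⁻¹ :=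
  eq_inv_mul_of_mul_eq (mul_galConj_eq_normCharacter_inv hD hj hK c hc hL)

/-- **The branch `ψ⁻¹` is its own reflection: `reflect ψ⁻¹ = ψ⁻¹`** (de Shalit II.6.1 (1):
`(ψ⁻¹)̌ = (ψ⁻¹ ∘ c)⁻¹ · ‖·‖ = (ψ ∘ c) · ‖·‖ = ψ⁻¹‖·‖⁻¹‖·‖ = ψ⁻¹`), for the crux's `ψ`, granted Deuring.
This is input (a) of the self-dual functional equation `stub_selfDual`.
[cite: deShalit1987, II.6.1 (1) (store chunk 81) and II.6.5 (store chunk 86)] -/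
theorem reflect_inv_eq_inv [IsCMField K] (hD : Deuring_exists_heckeCharacter_of_maximalCM)
    {A : WeierstrassCurve ℚ} [A.IsElliptic] [A.IsGloballyMinimal] (hj : A.j ∈ maximalCMJInvariants)
    (hK : IsCMFieldOfJ K A.j)
    {ψ : HeckeCharacter K} (hL : ∀ s : ℂ, 3 / 2 < s.re → heckeLFunction ψ s = A.LSeries s) :
    DeShalit1987.reflect ψ⁻¹ = ψ⁻¹ := by
  have h := galConj_eq_inv_mul_normCharacter_inv hD hj hK ((IsCMField.complexConj K).restrictScalars ℚ)
    Three.LambdaSupply.restrictScalars_complexConj_ne_one hL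
  rw [Three.LambdaSupply.galConj_restrictScalars] at h
  rw [DeShalit1987.reflect, HeckeCharacter.galConj_inv, inv_inv, h, mul_assoc, inv_mul_cancel, mul_one]

/-- **Conjugation-invariance of the ramification of `ψ`**: `ψ` is unramified at `c • w` iff at `w`
(since `ψ ∘ c = ψ⁻¹‖·‖⁻¹` has the ramification of `ψ`, and that of `ψ` transported by `c`). Granted
Deuring. [cite: SilvermanATAEC1994, Ch. II Thm. 10.5 (b)] [cite: deShalit1987, II.6.1 ("`𝔣_ε̌ = 𝔣̄_ε`", store chunk 81)] -/
theorem isUnramifiedAt_smul_iff (hD : Deuring_exists_heckeCharacter_of_maximalCM)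
    {A : WeierstrassCurve ℚ} [A.IsElliptic] [A.IsGloballyMinimal] (hj : A.j ∈ maximalCMJInvariants)
    (hK : IsCMFieldOfJ K A.j) (c : K ≃ₐ[ℚ] K) (hc : c ≠ 1)
    {ψ : HeckeCharacter K} (hL : ∀ s : ℂ, 3 / 2 < s.re → heckeLFunction ψ s = A.LSeries s)
    (w : HeightOneSpectrum (𝓞 K)) : ψ.IsUnramifiedAt (c • w) ↔ ψ.IsUnramifiedAt w := by
  have h := galConj_eq_inv_mul_normCharacter_inv hD hj hK c hc hL
  rw [← HeckeCharacter.isUnramifiedAt_galConj_iff c ψ w, h]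
  constructor
  · intro hu
    have h1 : ψ⁻¹.IsUnramifiedAt w := by
      have := hu.mul' (HeckeCharacter.isUnramifiedAt_normCharacter' w)
      rwa [mul_assoc, inv_mul_cancel, mul_one] at this
    simpa using h1.inv'
  · intro hu
    exact hu.inv'.mul' (HeckeCharacter.isUnramifiedAt_normCharacter' w).inv'

/-- **The exact modulus of the branch is conjugation-stable: `c • S = S`** for `S` the exact
ramification set of the crux's `ψ` (`w ∈ S ↔ ψ` ramified at `w`), granted Deuring. This is the second
half of input (a) of `stub_selfDual` (`thmII64…` returns a frame at the conjugate modulus `c • S`).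
[cite: deShalit1987, II.6.1 ("`𝔣_ε̌ = 𝔣̄_ε`", store chunk 81) and II.6.5 (store chunk 86)] -/
theorem image_smul_eq_self (hD : Deuring_exists_heckeCharacter_of_maximalCM)
    {A : WeierstrassCurve ℚ} [A.IsElliptic] [A.IsGloballyMinimal] (hj : A.j ∈ maximalCMJInvariants)
    (hK : IsCMFieldOfJ K A.j) (c : K ≃ₐ[ℚ] K) (hc : c ≠ 1)
    {ψ : HeckeCharacter K} (hL : ∀ s : ℂ, 3 / 2 < s.re → heckeLFunction ψ s = A.LSeries s)
    {S : Finset (HeightOneSpectrum (𝓞 K))} (hSram : ∀ w ∈ S, ¬ ψ.IsUnramifiedAt w)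
    (hSunr : ∀ w : HeightOneSpectrum (𝓞 K), w ∉ S → ψ.IsUnramifiedAt w) :
    S.image (fun w ↦ c • w) = S := by
  classical
  have hKiq : IsImaginaryQuadratic K :=
    Deuring_exists_heckeCharacter_of_maximalCM.isImaginaryQuadratic hj hK
  have key := isUnramifiedAt_smul_iff hD hj hK c hc hL
  have hmem : ∀ w, w ∈ S ↔ ¬ ψ.IsUnramifiedAt w :=
    fun w ↦ ⟨hSram w, fun h ↦ by_contra fun hw ↦ h (hSunr w hw)⟩
  have hcc : c * c = 1 := mul_self_eq_one_of_ne_one hKiq.1 hc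
  ext w
  simp only [Finset.mem_image]
  constructor
  · rintro ⟨u, hu, rfl⟩
    rw [hmem, key]
    exact (hmem u).mp hu
  · intro hw
    refine ⟨c • w, ?_, by rw [← mul_smul, hcc, one_smul]⟩
    rw [hmem, key]
    exact (hmem w).mp hw

/-- The same with the complex conjugation of the CM structure (`IsCMField.complexConj K`, the
automorphism by which `DeShalit1987.thmII64_katzMeasure₂_functionalEquation` conjugates the modulus):
`S.image (complexConj K • ·) = S`. [cite: deShalit1987, II.6.1 (store chunk 81) and II.6.4 (store chunk 84)] -/
theorem image_complexConj_smul_eq_self [IsCMField K] (hD : Deuring_exists_heckeCharacter_of_maximalCM)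
    {A : WeierstrassCurve ℚ} [A.IsElliptic] [A.IsGloballyMinimal] (hj : A.j ∈ maximalCMJInvariants)
    (hK : IsCMFieldOfJ K A.j)
    {ψ : HeckeCharacter K} (hL : ∀ s : ℂ, 3 / 2 < s.re → heckeLFunction ψ s = A.LSeries s)
    {S : Finset (HeightOneSpectrum (𝓞 K))} (hSram : ∀ w ∈ S, ¬ ψ.IsUnramifiedAt w)
    (hSunr : ∀ w : HeightOneSpectrum (𝓞 K), w ∉ S → ψ.IsUnramifiedAt w) :
    S.image (fun w ↦ IsCMField.complexConj K • w) = S :=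
  image_smul_eq_self hD hj hK ((IsCMField.complexConj K).restrictScalars ℚ)
    Three.LambdaSupply.restrictScalars_complexConj_ne_one hL hSram hSunr

end Summit.BirchSwinnertonDyer.BirchSwinnertonDyer.Theorems.CycTangentCMCycTangentBoundSelfDualCharacter

end
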